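import Mathlib
import Literature.NumberTheory.EllipticCurves.LeadingTermPPartRankLeOne
import Literature.NumberTheory.EllipticCurves.OrdinaryPrimesProofs
import HarnessLib

/-!
# W. Zhang 2014, Thm. 1.4 hypothesis (2): the exceptional primes of a curve form a finite set

Hypothesis (2) of W. Zhang, Camb. J. Math. 2 (2014), Thm. 1.4 — "every prime `ℓ ∥ N` with
`ℓ ≡ ±1 (mod p)` has `ρ̄_{E,p}` ramified at `ℓ`", i.e. `p ∤ v_ℓ(Δ_min)` (Tate), transcribed as the
binder `h2` of the named fact `WZhang2014_padicValRat_bsd_rank_one_ordinary`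
(`LeadingTermPPartRankLeOne.lean`) — can fail only at finitely many primes `p` of a given curve:
`WZhang2014_exceptionalPrimes_finite` (each such `p` divides `v_ℓ(Δ_min) ≥ 1` for some `ℓ ∣ Δ_min`)
and its `Filter.cofinite` form `WZhang2014_hyp2_eventually`.  This is the finiteness of the set
`Z*(E)` by which the excluded prime set of the Beilinson–Flach-free route "(P1′)" (Skinner–Urban
2014 Thm. 2 (a) in rank 0 + W. Zhang 2014 Thm. 1.6 in rank 1) exceeds
`{2, 3} ∪ {p ∣ N} ∪ {supersingular p}`.

What is NOT here.  The composition of the two named facts into Miller's `BSDp W p` is the tree's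
`Literature.NumberTheory.EllipticCurves.Rank1Residual.bsdp_of_S30_of_WZhang2014`
(`Rank1Residual/PPartGoodOrdinarySurj.lean`, with `bsdp_rankZero_of_S30` /
`bsdp_rankOne_of_WZhang2014`) — the theorem of record; an identical-name duplicate that briefly
lived in THIS file (first version, same day) was removed in favour of it, so that
`open … Rank1Residual` never meets an ambiguous `bsdp_of_S30_of_WZhang2014`.  Theorems only: no
definition, no named fact, no axiom.

## References

* W. Zhang, *Selmer groups and the indivisibility of Heegner points*, Camb. J. Math. 2 (2014)
  191–253, Thm. 1.4 (p. 197), hypothesis (2).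
* J. H. Silverman, *The Arithmetic of Elliptic Curves*, GTM 106, VII.5.1 (multiplicative reduction
  is bad reduction: `ℓ ∣ Δ_min`).
-/
noncomputable section

open scoped Classical
open WeierstrassCurve Literature.NumberTheory.EllipticCurves

namespace Literature.NumberTheory.EllipticCurves

/-- **The "Zhang-exceptional" primes of a curve form a finite set.** Call `p` exceptional for the
globally minimal curve `W` when hypothesis (2) of W. Zhang 2014, Thm. 1.4 fails at `p`: some prime
`ℓ` of multiplicative reduction (`ℓ ∥ N`) with `ℓ ≡ ±1 (mod p)` — i.e. `p ∣ ℓ - 1` or `p ∣ ℓ + 1` —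
has `p ∣ v_ℓ(Δ_min)` (by Tate's theory: `ρ̄_{E,p}` unramified at `ℓ`).  Then `ℓ` is a prime of bad
reduction, so `ℓ ∣ Δ_min ≠ 0`, `v_ℓ(Δ_min) ≥ 1`, and `p` is one of its finitely many divisors:
`{p exceptional} ⊆ ⋃_{ℓ ∣ Δ_min} divisors (v_ℓ(Δ_min))`. [folklore] -/
theorem WZhang2014_exceptionalPrimes_finite (W : WeierstrassCurve ℚ) [W.IsElliptic]
    [W.IsGloballyMinimal] :
    {p : ℕ | ∃ ℓ : ℕ, ∃ _ : Fact ℓ.Prime, W.HasMultiplicativeReductionAtPrime ℓ ∧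
      (p ∣ ℓ - 1 ∨ p ∣ ℓ + 1) ∧ p ∣ padicValInt ℓ W.minimalDiscriminantInt}.Finite := by
  refine (((minimalDiscriminantInt W).natAbs.primeFactors).biUnion
      (fun ℓ ↦ (padicValInt ℓ (minimalDiscriminantInt W)).divisors)).finite_toSet.subset ?_
  rintro p ⟨ℓ, hℓ, hm, -, hd⟩
  have hne : minimalDiscriminantInt W ≠ 0 := minimalDiscriminantInt_ne_zero W
  have hdvd : (ℓ : ℤ) ∣ minimalDiscriminantInt W := by
    by_contra hnd
    exact WeierstrassCurve.HasMultiplicativeReduction.not_hasGoodReduction (R := ℤ_[ℓ]) hm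
      (hasGoodReductionAtPrime_of_not_dvd W ℓ hnd)
  have hv : 1 ≤ padicValInt ℓ (minimalDiscriminantInt W) := by
    rcases (padicValInt_dvd_iff (p := ℓ) 1 (minimalDiscriminantInt W)).mp (by simpa using hdvd)
      with h | h
    · exact (hne h).elim
    · exact h
  rw [Finset.mem_coe, Finset.mem_biUnion]
  exact ⟨ℓ, Nat.mem_primeFactors.mpr ⟨hℓ.out, Int.natCast_dvd.mp hdvd, Int.natAbs_ne_zero.mpr hne⟩,
    Nat.mem_divisors.mpr ⟨hd, by omega⟩⟩

/-- **Zhang's hypothesis (2) holds at all but finitely many primes `p`** (the `Filter.cofinite`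
form of `WZhang2014_exceptionalPrimes_finite`): eventually along `cofinite`, every multiplicative
`ℓ ≡ ±1 (mod p)` has `p ∤ v_ℓ(Δ_min)` — the shape of the binder `h2` of
`WZhang2014_padicValRat_bsd_rank_one_ordinary`. [folklore] -/
theorem WZhang2014_hyp2_eventually (W : WeierstrassCurve ℚ) [W.IsElliptic] [W.IsGloballyMinimal] :
    ∀ᶠ p : ℕ in Filter.cofinite, ∀ (ℓ : ℕ) [Fact ℓ.Prime], W.HasMultiplicativeReductionAtPrime ℓ →
      (p ∣ ℓ - 1 ∨ p ∣ ℓ + 1) → ¬ p ∣ padicValInt ℓ W.minimalDiscriminantInt := by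
  refine (WZhang2014_exceptionalPrimes_finite W).compl_mem_cofinite |> Filter.mem_of_superset <| ?_
  intro p hp ℓ hℓ hm hc hd
  exact hp ⟨ℓ, hℓ, hm, hc, hd⟩

end Literature.NumberTheory.EllipticCurves

end
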